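import Summits.BirchSwinnertonDyer.BirchSwinnertonDyer.Theorems.Rank1ResidualX11KrausMinimality
import Literature.NumberTheory.EllipticCurves.Rank1Residual.X11RankOneCertificates.Minimality
import HarnessLib

/-!
# BSD rank-≤1 residual cell, class X11 ∧ r = 1 ∧ ¬sst ∧ p ≥ 5: the LAST instance binder of the
# 85 certificate records discharged in the kernel, and the window headline (`N < 2·10⁴`)

HONEST FRAMING (cell `b2b-bsdres-*`, verbatim): prove what is provable now; shrink each hard class
to its core with data; no claim beyond stated classes. The cell deletes COMBINATION-shaped residual
classes from PUBLISHED theorems only; the CONSTRUCTION-shaped remainder is typed, not attempted; this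
is not "finishing BSD". Class X11b (multiplicative `p`, `r = 1`) stays CONSTRUCTION-SHAPED; what
follows is PER PAIR (published named facts + a per-pair computation entered as a kernel-rechecked
record + the record's explicit `Claim`). No lane verdict is changed by this file.

Theorems only (no definition, no named fact). Unit `b2b-bsdres-x11c` (gen 0) landed, under
`Literature/…/Rank1Residual/X11RankOneCertificates/`, the 85 certificate records of the residual class
X11 ∧ `r = 1` ∧ ¬sst ∧ `p ≥ 5` in the lane window `N < 2·10⁴` (= the bsdN residue pairs of that
type) and the theorem "ten published named facts + the record's `Claim` ⟹ `BSD(E,p)`" for the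
record's model, with ONE instance hypothesis left, `[r.curve.IsGloballyMinimal]` — discharged by
Silverman's sufficient criterion (`Minimality.lean`, `minCheck`) for 79 of the 85 records; the six
exceptions (`minCheck_fails_exactly`) `6240be1`, `10080bo1`, `10080ca1`, `16560cf1`, `17360bo1`,
`15390b1` are minimal by Kraus's conditions at `2` / `3` (companion file
`Rank1ResidualX11KrausMinimality.lean`). This file:

* §3. `isGloballyMinimal_of_krausCriterion`: an integer model such that every prime `q` satisfies
  Silverman's criterion (`q¹² ∤ Δ` or `q⁴ ∤ c₄`) OR one of the three Kraus patterns (`q = 2`: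
  `2⁸ ∤ c₄ ∧ 2⁷ ∣ c₆`, or `2²⁴ ∤ Δ ∧ c₆ = 2⁹L, L ≡ 3 (mod 4)`; `q = 3`: `3⁸ ‖ c₆`) is globally
  minimal; bounded form `…_bounded` (`q < 512`, `|Δ| < 512¹²`).
* §4. `krausCriterion_all`: the bounded criterion holds for ALL 85 records (`decide`: the kernel
  recomputes `Δ`, `c₄`, `c₆` from the a-invariants and trial-divides), so
  `isGloballyMinimal_curve_of_mem`: every record's model is globally minimal, no hypothesis.
  HEADLINE `bsdp_of_claims` / `bsdp_of_published_of_claims`: for every one of the 85 records `r` of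
  `records1 ++ records2`, the published `Inputs` (resp. the TEN published named facts: Kato–Wuthrich
  surjective divisibility, Skinner 2016 Thm. A, Stein–Wuthrich 2013 Thm. 6.1 ×2, SW §4.2 height
  existence ×2, Wuthrich 2014 Prop. 21, Gross–Zagier–Kolyvagin, modularity ×2 — the MTT non-split
  existence being the tree THEOREM `exists_isMultPAdicLFunctionOf_neg_one_holds`) and the records'
  `Claims` give Miller's `BSD(E,p)` for `r.curve` at `r.p`, with NO instance hypothesis at all
  (`Fact r.p.Prime`, `IsElliptic` from the recheck — `Instances.lean` —, `IsGloballyMinimal` here).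

Per pair; the class label is unchanged; the `Claim`s (analytic rank `1`, reduction data, image of
`ρ̄`, `#Ш_an = 1`, the `p`-adic valuation identity) remain explicit hypotheses — engine outputs
(HOME/b2b-bsdres-x11c/REPORT.md §2: engines T/Y/P agree 85/85; `p`-adic part PARI + msengine), not
kernel facts.

References: A. Kraus, Acta Arith. 54 (1989), Prop. 1, Prop. 2 [Kraus1989]; J. H. Silverman, *AEC*
(2009) VII.1 Remark 1.1, VIII.8 [SilvermanAEC2009]; Stein–Wuthrich 2013 [SteinWuthrich2013];
Wuthrich 2014 [Wuthrich2014]; Skinner 2016 [Skinner2016PacificMC]; Mazur–Tate–Teitelbaum 1986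
[MazurTateTeitelbaum1986Invent]; Cremona's tables [Cremona2006].
-/

set_option linter.dupNamespace false
set_option autoImplicit false

noncomputable section

open scoped Classical

open IsDedekindDomain NumberField Rat.HeightOneSpectrum WeierstrassCurve
  Literature.NumberTheory.EllipticCurves Literature.NumberTheory.EllipticCurves.ModularForms
  Literature.NumberTheory.EllipticCurves.Skinner2016 Literature.NumberTheory.EllipticCurves.Wuthrich2014
  Literature.NumberTheory.EllipticCurves.SteinWuthrich2013
  Literature.NumberTheory.EllipticCurves.Rank1Residual.X11RankOneCertificates
  Literature.NumberTheory.GaloisRepresentations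

namespace Summit.BirchSwinnertonDyer.BirchSwinnertonDyer.Rank1Residual.X11RankOne


/-! ### §3. Global minimality of an integer model: Silverman's criterion or a Kraus pattern at every prime -/

/-- **An integer Weierstrass model is globally minimal when every prime `q` satisfies Silverman's
criterion (`q¹² ∤ Δ` or `q⁴ ∤ c₄`, AEC VII.1 Remark 1.1) or one of the Kraus patterns of `Rank1ResidualX11KrausMinimality.lean`**
(`q = 2`: `2⁸ ∤ c₄ ∧ 2⁷ ∣ c₆`, or `2²⁴ ∤ Δ ∧ c₆ = 2⁹L, L ≡ 3 (mod 4)`; `q = 3`: `3⁸ ‖ c₆`).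
`Δ`, `c₄`, `c₆` are the tree-rechecked integers `discOf`/`c4Of`/`c6Of` of `Schema.lean`.
[cite: SilvermanAEC2009, VII.1 Remark 1.1 and VIII.8] [cite: Kraus1989, Prop. 1 and Prop. 2] -/
theorem isGloballyMinimal_of_krausCriterion (a1 a2 a3 a4 a6 : ℤ)
    (h : ∀ q : ℕ, q.Prime →
      (¬ (q : ℤ) ^ 12 ∣ discOf [a1, a2, a3, a4, a6] ∨ ¬ (q : ℤ) ^ 4 ∣ c4Of [a1, a2, a3, a4, a6]) ∨
      (q = 2 ∧ ¬ (2 : ℤ) ^ 8 ∣ c4Of [a1, a2, a3, a4, a6] ∧ (2 : ℤ) ^ 7 ∣ c6Of [a1, a2, a3, a4, a6]) ∨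
      (q = 2 ∧ ¬ (2 : ℤ) ^ 24 ∣ discOf [a1, a2, a3, a4, a6] ∧
        ∃ L : ℤ, c6Of [a1, a2, a3, a4, a6] = 512 * L ∧ (4 : ℤ) ∣ L - 3) ∨
      (q = 3 ∧ (3 : ℤ) ^ 8 ∣ c6Of [a1, a2, a3, a4, a6] ∧ ¬ (3 : ℤ) ^ 9 ∣ c6Of [a1, a2, a3, a4, a6])) :
    (⟨a1, a2, a3, a4, a6⟩ : WeierstrassCurve ℚ).IsGloballyMinimal where
  isIntegral := isIntegral_of_exists_lift (𝓞 ℚ) ⟨(a1 : 𝓞 ℚ), by simp⟩ ⟨(a2 : 𝓞 ℚ), by simp⟩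
    ⟨(a3 : 𝓞 ℚ), by simp⟩ ⟨(a4 : 𝓞 ℚ), by simp⟩ ⟨(a6 : 𝓞 ℚ), by simp⟩
  isMinimal v := by
    set W : WeierstrassCurve ℚ := ⟨a1, a2, a3, a4, a6⟩ with hW
    have hle : ∀ m : ℤ, v.valuation ℚ (m : ℚ) ≤ 1 := fun m ↦ by
      have hm : (m : ℚ) = algebraMap (𝓞 ℚ) ℚ (m : 𝓞 ℚ) := by simp
      rw [hm]
      exact v.valuation_le_one _
    have hint : W.IsIntegralAt v :=
      W.isIntegralAt_of_valuation_le_one v (hle a1) (hle a2) (hle a3) (hle a4) (hle a6)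
    have hΔ : W.Δ = ((discOf [a1, a2, a3, a4, a6] : ℤ) : ℚ) := by
      simp only [hW, WeierstrassCurve.Δ, WeierstrassCurve.b₂, WeierstrassCurve.b₄, WeierstrassCurve.b₆,
        WeierstrassCurve.b₈, discOf, invariants]
      push_cast
      ring
    have hc4 : W.c₄ = ((c4Of [a1, a2, a3, a4, a6] : ℤ) : ℚ) := by
      simp only [hW, WeierstrassCurve.c₄, WeierstrassCurve.b₂, WeierstrassCurve.b₄, c4Of, invariants]
      push_cast
      ring
    have hc6 : W.c₆ = ((c6Of [a1, a2, a3, a4, a6] : ℤ) : ℚ) := by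
      simp only [hW, WeierstrassCurve.c₆, WeierstrassCurve.b₂, WeierstrassCurve.b₄, WeierstrassCurve.b₆,
        c6Of, invariants]
      push_cast
      ring
    -- the base change to `ℚ_v` and its valuations
    haveI hYint : (W.baseChange (v.adicCompletion ℚ)).IsIntegral (v.adicCompletionIntegers ℚ) := hint
    have hYc4 : Valued.v (W.baseChange (v.adicCompletion ℚ)).c₄ = v.valuation ℚ W.c₄ := by
      rw [WeierstrassCurve.baseChange, map_c₄, WeierstrassCurve.valued_algebraMap_adicCompletion]
    have hYc6 : Valued.v (W.baseChange (v.adicCompletion ℚ)).c₆ = v.valuation ℚ W.c₆ := by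
      rw [WeierstrassCurve.baseChange, map_c₆, WeierstrassCurve.valued_algebraMap_adicCompletion]
    rcases h _ (prime_natGenerator v) with (h12 | h4) | ⟨h2, h8, h7⟩ | ⟨h2, h24, L, hL, hL3⟩ |
        ⟨h3, h8, h9⟩
    · exact isMinimalAt_of_lt_valuation_Δ_holds hint
        (by rw [hΔ]; exact exp_neg_lt_valuation_intCast_of_not_pow_dvd v h12)
    · exact isMinimalAt_of_lt_valuation_c₄ hint
        (by rw [hc4]; exact exp_neg_lt_valuation_intCast_of_not_pow_dvd v h4)
    · -- pattern F2a at `2`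
      refine isMinimal_two_of_valued_c₄_c₆ v h2 _ ?_ ?_
      · rw [hYc4, hc4]
        exact exp_neg_lt_valuation_intCast_of_not_pow_dvd v (by rw [h2]; exact_mod_cast h8)
      · rw [hYc6, hc6]
        exact_mod_cast Rat.valuation_intCast_le v (e := 7) (by rw [h2]; exact_mod_cast h7)
    · -- pattern F2b at `2`
      refine isMinimalAt_two_of_c₆_eq_512_mul v W h2 hint ?_ (L := L) (by rw [hc6, hL]; push_cast; ring)
        hL3
      rw [hΔ]
      exact_mod_cast exp_neg_lt_valuation_intCast_of_not_pow_dvd v (e := 24) (by rw [h2]; exact_mod_cast h24)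
    · -- pattern F3 at `3`
      refine isMinimal_three_of_valued_c₆ v h3 _ ?_ ?_
      · rw [hYc6, hc6]
        exact_mod_cast Rat.valuation_intCast_le v (e := 8) (by rw [h3]; exact_mod_cast h8)
      · rw [hYc6, hc6]
        exact_mod_cast exp_neg_lt_valuation_intCast_of_not_pow_dvd v (e := 9)
          (by rw [h3]; exact_mod_cast h9)

/-- **Bounded form** (the shape `decide` evaluates): five a-invariants with `Δ ≠ 0`, `|Δ| < 512¹²`,
and for every `q < 512` the disjunction "`q < 2`, or `q¹² ∤ |Δ|`, or `q⁴ ∤ |c₄|`, or a Kraus pattern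
at `q = 2, 3`"; primes `q ≥ 512` have `q¹² > |Δ|`. [cite: SilvermanAEC2009, VII.1 Remark 1.1] -/
theorem isGloballyMinimal_of_krausCriterion_bounded (a1 a2 a3 a4 a6 : ℤ)
    (h0 : discOf [a1, a2, a3, a4, a6] ≠ 0) (hB : (discOf [a1, a2, a3, a4, a6]).natAbs < 512 ^ 12)
    (h : ∀ q < 512, q < 2 ∨ ¬ q ^ 12 ∣ (discOf [a1, a2, a3, a4, a6]).natAbs ∨
      ¬ q ^ 4 ∣ (c4Of [a1, a2, a3, a4, a6]).natAbs ∨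
      (q = 2 ∧ ¬ (2 : ℤ) ^ 8 ∣ c4Of [a1, a2, a3, a4, a6] ∧ (2 : ℤ) ^ 7 ∣ c6Of [a1, a2, a3, a4, a6]) ∨
      (q = 2 ∧ ¬ (2 : ℤ) ^ 24 ∣ discOf [a1, a2, a3, a4, a6] ∧ (512 : ℤ) ∣ c6Of [a1, a2, a3, a4, a6] ∧
        (4 : ℤ) ∣ c6Of [a1, a2, a3, a4, a6] / 512 - 3) ∨
      (q = 3 ∧ (3 : ℤ) ^ 8 ∣ c6Of [a1, a2, a3, a4, a6] ∧ ¬ (3 : ℤ) ^ 9 ∣ c6Of [a1, a2, a3, a4, a6])) :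
    (⟨a1, a2, a3, a4, a6⟩ : WeierstrassCurve ℚ).IsGloballyMinimal := by
  refine isGloballyMinimal_of_krausCriterion a1 a2 a3 a4 a6 fun q hq ↦ ?_
  have hpos : 0 < (discOf [a1, a2, a3, a4, a6]).natAbs := Int.natAbs_pos.mpr h0
  by_cases hqB : q < 512
  · rcases h q hqB with hlt | h12 | h4 | hF2a | ⟨h2, h24, h512, h43⟩ | hF3
    · exact absurd hq.two_le (by omega)
    · refine Or.inl (Or.inl fun h12' ↦ h12 ?_)
      rw [← Int.natCast_dvd]; exact_mod_cast h12'
    · refine Or.inl (Or.inr fun h4' ↦ h4 ?_)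
      rw [← Int.natCast_dvd]; exact_mod_cast h4'
    · exact Or.inr (Or.inl hF2a)
    · refine Or.inr (Or.inr (Or.inl ⟨h2, h24, c6Of [a1, a2, a3, a4, a6] / 512, ?_, h43⟩))
      exact (Int.mul_ediv_cancel' h512).symm
    · exact Or.inr (Or.inr (Or.inr hF3))
  · refine Or.inl (Or.inl fun h12 ↦ ?_)
    have h12' : q ^ 12 ∣ (discOf [a1, a2, a3, a4, a6]).natAbs := by
      rw [← Int.natCast_dvd]; exact_mod_cast h12
    have hle : q ^ 12 ≤ (discOf [a1, a2, a3, a4, a6]).natAbs := Nat.le_of_dvd hpos h12'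
    have hge : 512 ^ 12 ≤ q ^ 12 := Nat.pow_le_pow_left (by omega) 12
    omega

/-! ### §4. All 85 records: global minimality decided, and the window headline -/

-- `decide` evaluates `discOf`/`c4Of`/`c6Of` per record and trial-divides below `512`.
set_option maxRecDepth 100000 in
/-- **Every one of the 85 records satisfies the bounded Kraus/Silverman criterion** (kernel-evaluated;
the 79 `minCheck` records through Silverman's disjuncts, the six exceptions `6240be1`, `10080bo1`,
`10080ca1`, `16560cf1`, `17360bo1`, `15390b1` through the Kraus patterns). [folklore] -/
theorem krausCriterion_all : ∀ r ∈ records1 ++ records2,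
    r.ainvs.length = 5 ∧ discOf r.ainvs ≠ 0 ∧ (discOf r.ainvs).natAbs < 512 ^ 12 ∧
    ∀ q < 512, q < 2 ∨ ¬ q ^ 12 ∣ (discOf r.ainvs).natAbs ∨ ¬ q ^ 4 ∣ (c4Of r.ainvs).natAbs ∨
      (q = 2 ∧ ¬ (2 : ℤ) ^ 8 ∣ c4Of r.ainvs ∧ (2 : ℤ) ^ 7 ∣ c6Of r.ainvs) ∨
      (q = 2 ∧ ¬ (2 : ℤ) ^ 24 ∣ discOf r.ainvs ∧ (512 : ℤ) ∣ c6Of r.ainvs ∧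
        (4 : ℤ) ∣ c6Of r.ainvs / 512 - 3) ∨
      (q = 3 ∧ (3 : ℤ) ^ 8 ∣ c6Of r.ainvs ∧ ¬ (3 : ℤ) ^ 9 ∣ c6Of r.ainvs) := by
  decide +kernel

/-- **The model of every one of the 85 records is globally minimal** — decided in the kernel (no
hypothesis about the curve). [cite: SilvermanAEC2009, VII.1 Remark 1.1 and VIII.8] [cite: Kraus1989, Prop. 1 and Prop. 2] -/
theorem isGloballyMinimal_curve_of_mem (r : Record) (hr : r ∈ records1 ++ records2) :
    r.curve.IsGloballyMinimal := by
  obtain ⟨hlen, h0, hB, h⟩ := krausCriterion_all r hr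
  rcases hA : r.ainvs with _ | ⟨a1, _ | ⟨a2, _ | ⟨a3, _ | ⟨a4, _ | ⟨a6, _ | ⟨x, t⟩⟩⟩⟩⟩⟩ <;>
    simp [hA] at hlen
  rw [Record.curve_of_eq hA]
  rw [hA] at h0 hB h
  exact isGloballyMinimal_of_krausCriterion_bounded a1 a2 a3 a4 a6 h0 hB h

/-- The concatenated list of all 85 records is `Certified` (parts 1 and 2 are). [folklore] -/
theorem certified_all : Certified (records1 ++ records2) := by
  have h1 := certified_records1
  have h2 := certified_records2
  unfold Certified at h1 h2 ⊢
  rw [List.all_append, h1, h2]; rfl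

/-- **HEADLINE (window `N < 2·10⁴`, class X11 ∧ r = 1 ∧ ¬sst ∧ p ≥ 5): `BSD(E,p)` for every one of
the 85 residue pairs, with NO instance hypothesis**, from the published `Inputs` and the records'
`Claims` (the two/three-engine computation, HOME/b2b-bsdres-x11c/REPORT.md §2): `Fact r.p.Prime`,
`IsElliptic` come from the recheck (`Instances.lean`), `IsGloballyMinimal` from
`isGloballyMinimal_curve_of_mem`. Per pair; the class label is unchanged.
[cite: SteinWuthrich2013, Thm. 6.1 (p. 20) and §4.2] [cite: Wuthrich2014, Thm. 3 (p. 383), Cor. 19 (p. 398), Prop. 21 (p. 400)]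
[cite: Skinner2016PacificMC, Thm. A] [cite: MazurTateTeitelbaum1986Invent, §I.10–I.14 and §II.10] -/
theorem bsdp_of_claims (I : Inputs) (hcl : Claims (records1 ++ records2)) (r : Record)
    (hr : r ∈ records1 ++ records2) : BSDp r.curve r.p := by
  haveI := isGloballyMinimal_curve_of_mem r hr
  exact r.bsdp_of_claim' I (certified_all.check_of_mem hr) (hcl r hr)

/-- **HEADLINE from the TEN published named facts** (`inputs_of_published`; the eleventh input, MTT
non-split existence, is the tree THEOREM `exists_isMultPAdicLFunctionOf_neg_one_holds`): Kato–Wuthrich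
surjective divisibility `hK`, Skinner 2016 Thm. A `hA`, Stein–Wuthrich 2013 Thm. 6.1 split/non-split
`hJs`/`hJn`, SW §4.2 height existence `hHs`/`hHn`, Wuthrich 2014 Prop. 21 `hW`, Gross–Zagier–Kolyvagin
`hGZK`, modularity `hmod`/`hpar`; plus the 85 `Claims` ⟹ `BSD(E,p)` for all 85 record curves.
[cite: SteinWuthrich2013, Thm. 6.1 (p. 20) and §4.2] [cite: Wuthrich2014, Thm. 3 (p. 383), Cor. 19 (p. 398), Prop. 21 (p. 400)]
[cite: Skinner2016PacificMC, Thm. A] -/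
theorem bsdp_of_published_of_claims
    (hK : kato_charIdeal_dvd_multiplicative_of_surjective) (hA : thmA_charIdeal_multiplicative)
    (hJs : thm61_splitMultiplicative) (hJn : thm61_nonsplitMultiplicative)
    (hHs : exists_isSplitMultCanonical) (hHn : exists_isMultCanonical)
    (hW : Wuthrich2014.sha_dvd_analyticSha) (hGZK : rank_eq_analyticRank_of_analyticRank_le_one)
    (hmod : hasEntireLFunction_rat) (hpar : nonempty_modularParametrizationData)
    (hcl : Claims (records1 ++ records2)) (r : Record) (hr : r ∈ records1 ++ records2) :
    BSDp r.curve r.p :=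
  bsdp_of_claims (inputs_of_published hK hA hJs hJn hHs hHn hW hGZK hmod hpar) hcl r hr

/-- The 85 records are exactly 85 (`43 + 42`). [folklore] -/
theorem length_records : (records1 ++ records2).length = 85 := by decide

end Summit.BirchSwinnertonDyer.BirchSwinnertonDyer.Rank1Residual.X11RankOne

end
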